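/-
Origin: expansion seat `planner-pub-hodgecm-pv13-g5-0`, handover #5 2026-08-18T13:3xZ (md5 3313bc4a2db7d9cbbc52d1a0751f6b85; NEW additive leaf; ONE import rewrite Pv13g5.GenuineSchrodingerRigid -> HodgeCM.PerL34.GenuineSchrodingerRigid (my #3, same run) by the generic ^import Pv[0-9]+g[0-9]+\. rule; land AFTER my #3; HOLD iff #3 is held) (`HOME/pub-hodgecm-pv13-g5/lean/Pv13g5/GenuineSchrodingerHeisenberg.lean`, md5 3313bc4a, 359 lines);
landed by the gen-8 packager in gate run 30 as `HodgeCM/PerL34/GenuineSchrodingerHeisenberg.lean` (import ^import Pv13g5\.GenuineSchrodingerRigid[ \t]*$→import HodgeCM.PerL34.GenuineSchrodingerRigid ×1).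
-/
/-
Copyright (c) 2026. All rights reserved.
Released under Apache 2.0 license as described in the file LICENSE.
Authors: unit pub-hodgecm-pv13-g5 (DAG-NODE PROVER #13, seam S3, 𝓕-side).

# HodgeCM/PerL34/GenuineSchrodingerHeisenberg.lean — the ADELIC Heisenberg characters
# `u ↦ ψ_𝔸(⟨ξ, u⟩)`, `ξ ∈ X`, on the global split Schrödinger space `X`, the Schrödinger
# representation of the adelic Heisenberg group of `X ⊕ X` on `L²(X)`, its irreducibility, and the
# Levi rigidity in print's shape `ω(k) M_ξ ω(k)⁻¹ = M_{k•ξ}`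
-/
import Summits.HodgeConjecture.HodgeCM.PerL34.GenuineSchrodingerRigid_2

/-!
# The adelic Heisenberg group on `L²(X)`

`X = Space L = Πʳ_{v split} [(L⁺_v)³, 𝒪_v³]` (RUN 29) carries the translations `τ_y` (`y ∈ X`) and the
modulations `M_χ` (`χ ∈ C(X, S¹)`) of `HodgeCM/PerL34/LocalFactors/SchrodingerLevi.lean`.  File #3 of this
seat (`GenuineSchrodingerRigid`) used only the COORDINATE Heisenberg characters `u ↦ ψ_v(s·u_{v,j})`.
Print's Heisenberg group ([MVW] ch. 2 I.3–I.4; PerL v5 tex ll. 259–263: the global Weil representation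
lives on functions on an adelic space) is indexed by the whole of `X ⊕ X*`, `X* ≅ X` through a global
additive character `ψ_𝔸 = ∏_v ψ_v`.  This file builds exactly that, for ANY family `ψ = (ψ_v)` of
continuous additive characters of the split completions which is UNRAMIFIED ALMOST EVERYWHERE
(`ψ_v(𝒪_v) = 1` for all but finitely many split `v` — DATA supplied by the caller, as every global
additive character of `𝔸_{L⁺}` is):

* §1 `heisPairing ψ hψc ξ u = ∏ᶠ_v ψ_v(∑_j ξ_{v,j} u_{v,j})` — a finite product for `ξ, u ∈ X`
  (`hasFiniteMulSupport_locFactor`: off the finitely many ramified `v` and the finitely many `v` with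
  `ξ_v ∉ 𝒪_v³` or `u_v ∉ 𝒪_v³`, the factor is `1`); bi-additive and SYMMETRIC.
* §2 `heisCharA ψ hψc hψO ξ : C(X, S¹)` — the adelic Heisenberg character `u ↦ ψ_𝔸(⟨ξ, u⟩)` is
  CONTINUOUS (it is a character of `X` which on the compact open subgroup `∏_v 𝒪_v³` is a finite product
  of continuous local factors); `heisCharA_add` (`M_{ξ+ξ'} = M_ξ M_{ξ'}`), and the Levi equivariance
  `heisCharA_comp_smulMap : ψ_𝔸(⟨ξ, k•u⟩) = ψ_𝔸(⟨k•ξ, u⟩)`, i.e. `M_ξ ∘ (k•·) = M_{k•ξ}`.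
* §3 `singleAt` (the vector of `X` supported at one split place) and
  `heisCharA_singleAt : ψ_𝔸(⟨s·e_{v,j}, ·⟩) = ` the coordinate character of #3 — so the set
  `heisCharSetA = {ψ_𝔸(⟨ξ,·⟩) : ξ ∈ X}` contains #3's separating family, and
  **`hasScalarCommutant_heisenberg`**: the adelic Schrödinger system `{τ_y} ∪ {M_ξ}` (`y, ξ ∈ X`) has
  SCALAR COMMUTANT on `L²(X)` (irreducibility of the Schrödinger representation of the adelic
  Heisenberg group, from #3 §4), provided the `ψ_v` are non-trivial.
* §4 the HEISENBERG COMMUTATION RELATION `τ_y M_ξ = ψ_𝔸(⟨ξ, y⟩) • M_ξ τ_y` on `L²(X)`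
  (`translate_modulate_heisCharA`), the Levi relation `rep L ν k ∘ M_ξ = M_{k•ξ} ∘ rep L ν k`
  (`rep_modulate_heisCharA`), and **`rep_unique_of_heisenberg`**: a unitary representation `ω` of
  `Model L = U(1)(𝔸_{L⁺})` on `L²(X)` with `ω(k) τ_y = τ_{k⁻¹•y} ω(k)` and `ω(k) M_ξ = M_{k•ξ} ω(k)` for all
  `y, ξ ∈ X` IS `rep L ν` for a unique unitary character `ν` — PerL v5 L4.2(b)'s split sentence
  (tex l. 611, "up to a unitary character") in the adelic Heisenberg-group language of ll. 259–263.

ABSOLUTE RULE.  Nothing is cited and nothing is posited; the unramified-almost-everywhere property of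
`ψ` and the non-triviality of the `ψ_v` are hypotheses on caller-supplied DATA, not facts about a named
object.  Mathlib + landed package files + this seat's #3 only.
-/

set_option autoImplicit false

noncomputable section

open MeasureTheory MeasureTheory.Measure Set Metric Function Complex Topology Filter
open scoped RestrictedProduct InnerProductSpace NNReal ENNReal

namespace HodgeCM.PerL34.PureTensor.SchrodingerModel

open HodgeCM.PerL34.LocalFactors HodgeCM.PerL34.LocalFactors.DilationModel
open HodgeCM.PerL34.LocalFactors.SchrodingerLevi HodgeCM.PerL34.LocalFactors.SchrodingerIrreducible
open HodgeCM.PerL34.IdelePlaces HodgeCM.PerL34.IdelicTorusModel HodgeCM.PerL34.IdelicTorusModel.Genuine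
open NumberField IsDedekindDomain

attribute [local instance] LocalFactors.DilationModel.Adic.nontriviallyNormedField
  LocalFactors.DilationModel.Adic.properSpace

variable {L : Type} [Field L] [NumberField L] [IsCMField L]

/-- an additive character turns finite sums into finite products -/
theorem addChar_map_finset_sum {ι A M : Type*} [AddCommMonoid A] [CommMonoid M] (φ : AddChar A M)
    (s : Finset ι) (a : ι → A) : φ (∑ i ∈ s, a i) = ∏ i ∈ s, φ (a i) := by
  induction s using Finset.cons_induction with
  | empty => simp
  | cons i s hi ih => rw [Finset.sum_cons, Finset.prod_cons, AddChar.map_add_eq_mul, ih]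

section Characters

variable (ψ : ∀ i : SplitIdx L, AddChar ((basePlaceOf L i.1).adicCompletion (maximalRealSubfield L)) Circle)
  (hψc : ∀ i, Continuous (ψ i))

/-! ## §1  The local factors `ψ_v(⟨ξ_v, u_v⟩)` and the finite product `ψ_𝔸(⟨ξ, u⟩)` -/

/-- the local factor at the split place `v`: `ψ_v(∑_j ξ_{v,j} u_{v,j})` (the RUN-28 local Heisenberg
character `heisChar (ψ v)` of `ξ_v`, evaluated at `u_v`) -/
def locFactor (ξ u : Space L) (i : SplitIdx L) : Circle := heisChar (ψ i) (hψc i) (ξ i) (u i)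

/-- (Ported verbatim from the HodgeCMPerL package; no docstring in the source.) -/
theorem locFactor_apply (ξ u : Space L) (i : SplitIdx L) :
    locFactor ψ hψc ξ u i = ψ i (∑ j, ξ i j * u i j) := rfl

/-- (Ported verbatim from the HodgeCMPerL package; no docstring in the source.) -/
theorem locFactor_comm (ξ u : Space L) (i : SplitIdx L) : locFactor ψ hψc ξ u i = locFactor ψ hψc u ξ i := by
  simp only [locFactor_apply, mul_comm (ξ i _)]

/-- (Ported verbatim from the HodgeCMPerL package; no docstring in the source.) -/
theorem locFactor_add_right (ξ u u' : Space L) (i : SplitIdx L) :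
    locFactor ψ hψc ξ (u + u') i = locFactor ψ hψc ξ u i * locFactor ψ hψc ξ u' i := by
  simp only [locFactor_apply, RestrictedProduct.add_apply, Pi.add_apply, mul_add, Finset.sum_add_distrib,
    AddChar.map_add_eq_mul]

/-- (Ported verbatim from the HodgeCMPerL package; no docstring in the source.) -/
theorem locFactor_add_left (ξ ξ' u : Space L) (i : SplitIdx L) :
    locFactor ψ hψc (ξ + ξ') u i = locFactor ψ hψc ξ u i * locFactor ψ hψc ξ' u i := by
  rw [locFactor_comm, locFactor_add_right, locFactor_comm ψ hψc u ξ, locFactor_comm ψ hψc u ξ']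

/-- (Ported verbatim from the HodgeCMPerL package; no docstring in the source.) -/
theorem locFactor_zero_right (ξ : Space L) (i : SplitIdx L) : locFactor ψ hψc ξ 0 i = 1 := by
  simp [locFactor_apply]

/-- (Ported verbatim from the HodgeCMPerL package; no docstring in the source.) -/
theorem locFactor_zero_left (u : Space L) (i : SplitIdx L) : locFactor ψ hψc 0 u i = 1 := by
  rw [locFactor_comm, locFactor_zero_right]

/-- At a place where `ψ_v` is unramified (`ψ_v(𝒪_v) = 1`) and both `ξ_v, u_v ∈ 𝒪_v³`, the local factor
is `1`. -/
theorem locFactor_eq_one_of_mem {ξ u : Space L} {i : SplitIdx L}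
    (hψi : ∀ t : (basePlaceOf L i.1).adicCompletion (maximalRealSubfield L), ‖t‖ ≤ 1 → ψ i t = 1)
    (hξ : ξ i ∈ cube L i) (hu : u i ∈ cube L i) : locFactor ψ hψc ξ u i = 1 := by
  rw [locFactor_apply, addChar_map_finset_sum]
  refine Finset.prod_eq_one fun j _ => hψi _ ?_
  rw [mem_cube_iff] at hξ hu
  rw [norm_mul]
  exact mul_le_one₀ ((norm_le_pi_norm _ j).trans hξ) (norm_nonneg _) ((norm_le_pi_norm _ j).trans hu)

/-- the local factors of `ψ_𝔸(⟨ξ, u⟩)` are `1` for all but finitely many `v`, as soon as `ψ` is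
unramified almost everywhere -/
theorem hasFiniteMulSupport_locFactor
    (hψO : ∀ᶠ i : SplitIdx L in cofinite,
      ∀ t : (basePlaceOf L i.1).adicCompletion (maximalRealSubfield L), ‖t‖ ≤ 1 → ψ i t = 1)
    (ξ u : Space L) : HasFiniteMulSupport (locFactor ψ hψc ξ u) := by
  have h : ∀ᶠ i : SplitIdx L in cofinite, locFactor ψ hψc ξ u i = 1 := by
    filter_upwards [hψO, ξ.2, u.2] with i h1 h2 h3
    exact locFactor_eq_one_of_mem ψ hψc h1 h2 h3
  exact (eventually_cofinite.1 h).subset fun i hi => hi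

/-- On the box `∏_v 𝒪_v³` the support is contained in a FIXED finite set depending on `ξ` only:
the ramified places of `ψ` together with the places where `ξ_v ∉ 𝒪_v³`. -/
theorem exists_finset_mulSupport_subset
    (hψO : ∀ᶠ i : SplitIdx L in cofinite,
      ∀ t : (basePlaceOf L i.1).adicCompletion (maximalRealSubfield L), ‖t‖ ≤ 1 → ψ i t = 1)
    (ξ : Space L) : ∃ T : Finset (SplitIdx L), ∀ u ∈ (box L : Set (Space L)),
      mulSupport (locFactor ψ hψc ξ u) ⊆ T := by
  have hfin : Set.Finite {i : SplitIdx L | ¬ ((∀ t : (basePlaceOf L i.1).adicCompletion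
      (maximalRealSubfield L), ‖t‖ ≤ 1 → ψ i t = 1) ∧ ξ i ∈ cube L i)} :=
    eventually_cofinite.1 (hψO.and ξ.2)
  refine ⟨hfin.toFinset, fun u hu i hi => ?_⟩
  rw [Set.Finite.coe_toFinset]
  intro h
  exact hi (locFactor_eq_one_of_mem ψ hψc h.1 h.2 ((mem_box_iff L u).1 hu i))

/-- **the adelic heisPairing** `ψ_𝔸(⟨ξ, u⟩) = ∏_v ψ_v(∑_j ξ_{v,j} u_{v,j})` (a finite product) -/
def heisPairing (ξ u : Space L) : Circle := ∏ᶠ i, locFactor ψ hψc ξ u i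

/-- (Ported verbatim from the HodgeCMPerL package; no docstring in the source.) -/
theorem heisPairing_comm (ξ u : Space L) : heisPairing ψ hψc ξ u = heisPairing ψ hψc u ξ := by
  unfold heisPairing
  exact finprod_congr fun i => locFactor_comm ψ hψc ξ u i

/-- (Ported verbatim from the HodgeCMPerL package; no docstring in the source.) -/
theorem heisPairing_zero_right (ξ : Space L) : heisPairing ψ hψc ξ 0 = 1 :=
  finprod_eq_one_of_forall_eq_one fun i => locFactor_zero_right ψ hψc ξ i

/-- (Ported verbatim from the HodgeCMPerL package; no docstring in the source.) -/
theorem heisPairing_zero_left (u : Space L) : heisPairing ψ hψc 0 u = 1 :=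
  finprod_eq_one_of_forall_eq_one fun i => locFactor_zero_left ψ hψc u i

/-- (Ported verbatim from the HodgeCMPerL package; no docstring in the source.) -/
theorem heisPairing_eq_prod {ξ u : Space L} {T : Finset (SplitIdx L)} (h : mulSupport (locFactor ψ hψc ξ u) ⊆ T) :
    heisPairing ψ hψc ξ u = ∏ i ∈ T, locFactor ψ hψc ξ u i :=
  finprod_eq_prod_of_mulSupport_subset _ h

section Unramified

variable (hψO : ∀ᶠ i : SplitIdx L in cofinite,
  ∀ t : (basePlaceOf L i.1).adicCompletion (maximalRealSubfield L), ‖t‖ ≤ 1 → ψ i t = 1)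
include hψO

/-- (Ported verbatim from the HodgeCMPerL package; no docstring in the source.) -/
theorem heisPairing_add_right (ξ u u' : Space L) :
    heisPairing ψ hψc ξ (u + u') = heisPairing ψ hψc ξ u * heisPairing ψ hψc ξ u' := by
  unfold heisPairing
  rw [← finprod_mul_distrib (hasFiniteMulSupport_locFactor ψ hψc hψO ξ u)
    (hasFiniteMulSupport_locFactor ψ hψc hψO ξ u')]
  exact finprod_congr fun i => locFactor_add_right ψ hψc ξ u u' i

/-- (Ported verbatim from the HodgeCMPerL package; no docstring in the source.) -/
theorem heisPairing_add_left (ξ ξ' u : Space L) :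
    heisPairing ψ hψc (ξ + ξ') u = heisPairing ψ hψc ξ u * heisPairing ψ hψc ξ' u := by
  rw [heisPairing_comm, heisPairing_add_right ψ hψc hψO, heisPairing_comm ψ hψc u ξ, heisPairing_comm ψ hψc u ξ']

/-- (Ported verbatim from the HodgeCMPerL package; no docstring in the source.) -/
theorem heisPairing_sub_right (ξ u u' : Space L) :
    heisPairing ψ hψc ξ (u - u') * heisPairing ψ hψc ξ u' = heisPairing ψ hψc ξ u := by
  rw [← heisPairing_add_right ψ hψc hψO, sub_add_cancel]

/-! ## §2  The adelic Heisenberg character `u ↦ ψ_𝔸(⟨ξ, u⟩)` is continuous -/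

/-- `u ↦ ψ_𝔸(⟨ξ, u⟩)` is continuous at `0`: on the open subgroup `∏_v 𝒪_v³` it is a FINITE product of
continuous local factors. -/
theorem continuousAt_heisPairing_zero (ξ : Space L) : ContinuousAt (heisPairing ψ hψc ξ) 0 := by
  obtain ⟨T, hT⟩ := exists_finset_mulSupport_subset ψ hψc hψO ξ
  have hg : Continuous fun u : Space L => ∏ i ∈ T, locFactor ψ hψc ξ u i :=
    continuous_finsetProd _ fun i _ =>
      (heisChar (ψ i) (hψc i) (ξ i)).continuous.comp (RestrictedProduct.continuous_eval i)
  refine hg.continuousAt.congr ?_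
  filter_upwards [(isOpen_box L).mem_nhds ((mem_box_iff L 0).2 fun i => zero_mem (cube L i))] with u hu
  exact (heisPairing_eq_prod ψ hψc (hT u hu)).symm

/-- `u ↦ ψ_𝔸(⟨ξ, u⟩)` is continuous on `X` (a character continuous at `0`). -/
theorem continuous_heisPairing (ξ : Space L) : Continuous (heisPairing ψ hψc ξ) := by
  rw [continuous_iff_continuousAt]
  intro u₀
  have hfac : heisPairing ψ hψc ξ = fun u => heisPairing ψ hψc ξ (u - u₀) * heisPairing ψ hψc ξ u₀ := by
    funext u; exact (heisPairing_sub_right ψ hψc hψO ξ u u₀).symm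
  rw [hfac]
  refine ContinuousAt.mul ?_ continuousAt_const
  exact (continuousAt_heisPairing_zero ψ hψc hψO ξ).comp_of_eq (continuousAt_id.sub continuousAt_const)
    (sub_self u₀)

/-- **the adelic Heisenberg character** `M_ξ : u ↦ ψ_𝔸(⟨ξ, u⟩)` of `X`, `ξ ∈ X` ([MVW] ch. 2 I.3 (3),
adelically: the characters of `X` given by `X* ≅ X` through `ψ_𝔸`) -/
def heisCharA (ξ : Space L) : C(Space L, Circle) := ⟨heisPairing ψ hψc ξ, continuous_heisPairing ψ hψc hψO ξ⟩

/-- (Ported verbatim from the HodgeCMPerL package; no docstring in the source.) -/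
@[simp]
theorem heisCharA_apply (ξ u : Space L) : heisCharA ψ hψc hψO ξ u = heisPairing ψ hψc ξ u := rfl

/-- `M_{ξ + ξ'} = M_ξ · M_{ξ'}` -/
theorem heisCharA_add (ξ ξ' : Space L) :
    heisCharA ψ hψc hψO (ξ + ξ') = heisCharA ψ hψc hψO ξ * heisCharA ψ hψc hψO ξ' := by
  ext u
  simp only [heisCharA_apply, ContinuousMap.mul_apply, Circle.coe_mul, heisPairing_add_left ψ hψc hψO]

/-- (Ported verbatim from the HodgeCMPerL package; no docstring in the source.) -/
theorem heisCharA_zero : heisCharA ψ hψc hψO 0 = 1 := by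
  ext u
  simp only [heisCharA_apply, heisPairing_zero_left, ContinuousMap.one_apply]

/-- each `M_ξ` is a CHARACTER of `X` -/
theorem heisCharA_apply_add (ξ u u' : Space L) :
    heisCharA ψ hψc hψO ξ (u + u') = heisCharA ψ hψc hψO ξ u * heisCharA ψ hψc hψO ξ u' :=
  heisPairing_add_right ψ hψc hψO ξ u u'

/-- SYMMETRY of the pairing: `ψ_𝔸(⟨ξ, u⟩) = ψ_𝔸(⟨u, ξ⟩)` -/
theorem heisCharA_apply_comm (ξ u : Space L) : heisCharA ψ hψc hψO ξ u = heisCharA ψ hψc hψO u ξ :=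
  heisPairing_comm ψ hψc ξ u

/-- **Levi equivariance** `M_ξ ∘ (k • ·) = M_{k • ξ}`: `ψ_𝔸(⟨ξ, k•u⟩) = ψ_𝔸(⟨k•ξ, u⟩)` (the model group
acts on `X` by the SCALARS `k_v ∈ (L⁺_v)ˣ` coordinatewise, and the pairing is bilinear). -/
theorem heisCharA_comp_smulMap (ξ : Space L) (k : Model L) :
    (heisCharA ψ hψc hψO ξ).comp (smulMap k) = heisCharA ψ hψc hψO (k • ξ) := by
  ext u
  rw [ContinuousMap.comp_apply, smulMap_apply, heisCharA_apply, heisCharA_apply]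
  unfold heisPairing
  congr 1
  refine finprod_congr fun i => ?_
  simp only [locFactor_apply, smul_apply, Pi.smul_apply, smul_eq_mul]
  congr 2
  funext j
  ring

/-! ## §3  Vectors supported at one place; the coordinate characters are adelic Heisenberg characters;
irreducibility -/

omit hψO in
/-- the vector of `X` equal to `x ∈ (L⁺_v)³` at the split place `v` and `0` elsewhere -/
def singleAt [DecidableEq (Place (maximalRealSubfield L))] (i : SplitIdx L) (x : Coord L i) : Space L :=
  ⟨Pi.single i x, by
    refine eventually_cofinite.2 ((Set.finite_singleton i).subset fun i' hi' => ?_)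
    by_contra hne
    exact hi' (by rw [Pi.single_eq_of_ne hne]; exact zero_mem (cube L i'))⟩

omit hψO in
/-- (Ported verbatim from the HodgeCMPerL package; no docstring in the source.) -/
@[simp]
theorem singleAt_apply_self [DecidableEq (Place (maximalRealSubfield L))] (i : SplitIdx L) (x : Coord L i) :
    singleAt i x i = x :=
  Pi.single_eq_same i x

omit hψO in
/-- (Ported verbatim from the HodgeCMPerL package; no docstring in the source.) -/
theorem singleAt_apply_of_ne [DecidableEq (Place (maximalRealSubfield L))] {i i' : SplitIdx L} (h : i' ≠ i)
    (x : Coord L i) : singleAt i x i' = 0 :=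
  Pi.single_eq_of_ne h x

/-- `ψ_𝔸(⟨s·e_{v,j}, u⟩) = ψ_v(s · u_{v,j})`: #3's adelic COORDINATE Heisenberg characters are the adelic
Heisenberg characters of the vectors `s·e_{v,j} ∈ X`. -/
theorem heisCharA_singleAt [DecidableEq (Place (maximalRealSubfield L))] (i : SplitIdx L) (j : Fin 3)
    (s : (basePlaceOf L i.1).adicCompletion (maximalRealSubfield L)) :
    heisCharA ψ hψc hψO (singleAt i (Pi.single j s)) = adelicCoordChar ψ hψc i j s := by
  ext u
  rw [heisCharA_apply, adelicCoordChar_apply]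
  unfold heisPairing
  rw [finprod_eq_single _ i fun i' hi' => by
    rw [locFactor_apply, singleAt_apply_of_ne hi']; simp]
  rw [locFactor_apply, singleAt_apply_self]
  congr 2
  rw [Finset.sum_eq_single j (fun j' _ hj' => by rw [Pi.single_eq_of_ne hj', zero_mul])
    (fun h => absurd (Finset.mem_univ j) h), Pi.single_eq_same]

/-- the SET of adelic Heisenberg characters `{M_ξ : ξ ∈ X}` -/
def heisCharSetA : Set C(Space L, Circle) := Set.range (heisCharA ψ hψc hψO)

/-- (Ported verbatim from the HodgeCMPerL package; no docstring in the source.) -/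
theorem heisCharA_mem_heisCharSetA (ξ : Space L) : heisCharA ψ hψc hψO ξ ∈ heisCharSetA ψ hψc hψO := ⟨ξ, rfl⟩

/-- (Ported verbatim from the HodgeCMPerL package; no docstring in the source.) -/
theorem adelicCoordChar_mem_heisCharSetA [DecidableEq (Place (maximalRealSubfield L))] (i : SplitIdx L)
    (j : Fin 3) (s : (basePlaceOf L i.1).adicCompletion (maximalRealSubfield L)) :
    adelicCoordChar ψ hψc i j s ∈ heisCharSetA ψ hψc hψO :=
  ⟨singleAt i (Pi.single j s), heisCharA_singleAt ψ hψc hψO i j s⟩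

/-- **Irreducibility of the Schrödinger representation of the adelic Heisenberg group on `L²(X)`**:
the translations `τ_y` (`y ∈ X`) and the adelic Heisenberg modulations `M_ξ` (`ξ ∈ X`) have SCALAR
COMMUTANT in `B(L²(X))`, for every almost-everywhere-unramified family `ψ` of NON-TRIVIAL continuous
additive characters (#3 §4, the set of characters now being print's). -/
theorem hasScalarCommutant_heisenberg [DecidableEq (Place (maximalRealSubfield L))]
    (hψ : ∀ i, ∃ t, ψ i t ≠ 1) :
    HasScalarCommutant (Lp ℂ 2 (μ L)) (schrodingerSystem (μ L) (heisCharSetA ψ hψc hψO)) :=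
  hasScalarCommutant_schrodingerSystem_space ψ hψc hψ _ (adelicCoordChar_mem_heisCharSetA ψ hψc hψO)

/-! ## §4  The Heisenberg commutation relation on `L²(X)` and the Levi rigidity in print's shape -/

/-- **Heisenberg commutation relation on `L²(X)`**: `τ_y M_ξ = ψ_𝔸(⟨ξ, y⟩) • M_ξ τ_y` — translations by
`X` and modulations by `X* ≅ X` generate the Schrödinger representation of the adelic Heisenberg group,
the centre acting by the scalars `ψ_𝔸(⟨ξ, y⟩)`. -/
theorem translate_modulate_heisCharA (y ξ : Space L) (f : Lp ℂ 2 (μ L)) :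
    translate (μ L) y (modulate (μ L) (heisCharA ψ hψc hψO ξ) f)
      = (heisCharA ψ hψc hψO ξ y : ℂ) • modulate (μ L) (heisCharA ψ hψc hψO ξ) (translate (μ L) y f) :=
  translate_modulate_of_char (μ L) _ (heisCharA_apply_add ψ hψc hψO ξ) y f

/-- the RUN-29 representations satisfy the Levi relation of the Weil representation in print's shape:
`rep L ν k ∘ M_ξ = M_{k • ξ} ∘ rep L ν k` -/
theorem rep_modulate_heisCharA (ν : Model L →* Circle) (k : Model L) (ξ : Space L) (f : Lp ℂ 2 (μ L)) :
    rep L ν k (modulate (μ L) (heisCharA ψ hψc hψO ξ) f)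
      = modulate (μ L) (heisCharA ψ hψc hψO (k • ξ)) (rep L ν k f) := by
  rw [rep_modulate, heisCharA_comp_smulMap]

/-- **Levi rigidity in the adelic Heisenberg-group language (PerL v5 L4.2(b) split sentence, globally).**
A unitary representation `ω` of `Model L = U(1)(𝔸_{L⁺})` on `L²(X)` normalising the Schrödinger
representation of the adelic Heisenberg group as the Weil representation does on the Levi —
`ω(k) τ_y = τ_{k⁻¹•y} ω(k)` and `ω(k) M_ξ = M_{k•ξ} ω(k)` for all `y, ξ ∈ X` — IS `rep L ν`,
`(ω(k)f)(x) = ν(k) δ_X(k)^{1/2} f(k⁻¹•x)`, for a UNIQUE unitary character `ν`. -/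
theorem rep_unique_of_heisenberg [DecidableEq (Place (maximalRealSubfield L))] (hψ : ∀ i, ∃ t, ψ i t ≠ 1)
    (ω : Model L →* (Lp ℂ 2 (μ L) ≃ₗᵢ[ℂ] Lp ℂ 2 (μ L)))
    (hτ : ∀ (k : Model L) (y : Space L) (f : Lp ℂ 2 (μ L)),
      ω k (translate (μ L) y f) = translate (μ L) (k⁻¹ • y) (ω k f))
    (hM : ∀ (k : Model L) (ξ : Space L) (f : Lp ℂ 2 (μ L)),
      ω k (modulate (μ L) (heisCharA ψ hψc hψO ξ) f)
        = modulate (μ L) (heisCharA ψ hψc hψO (k • ξ)) (ω k f)) :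
    ∃! ν : Model L →* Circle, ω = rep L ν := by
  refine rep_unique_up_to_character ψ hψc hψ (heisCharSetA ψ hψc hψO)
    (adelicCoordChar_mem_heisCharSetA ψ hψc hψO) ω hτ ?_
  rintro k χ ⟨ξ, rfl⟩ f
  rw [heisCharA_comp_smulMap]
  exact hM k ξ f

/-- and the characterisation: `ω = rep L ν` for some `ν` iff the two relations hold -/
theorem exists_eq_rep_iff_heisenberg [DecidableEq (Place (maximalRealSubfield L))] (hψ : ∀ i, ∃ t, ψ i t ≠ 1)
    (ω : Model L →* (Lp ℂ 2 (μ L) ≃ₗᵢ[ℂ] Lp ℂ 2 (μ L))) :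
    (∃ ν : Model L →* Circle, ω = rep L ν) ↔
      (∀ (k : Model L) (y : Space L) (f : Lp ℂ 2 (μ L)),
          ω k (translate (μ L) y f) = translate (μ L) (k⁻¹ • y) (ω k f)) ∧
        ∀ (k : Model L) (ξ : Space L) (f : Lp ℂ 2 (μ L)),
          ω k (modulate (μ L) (heisCharA ψ hψc hψO ξ) f)
            = modulate (μ L) (heisCharA ψ hψc hψO (k • ξ)) (ω k f) := by
  refine ⟨?_, fun h => (rep_unique_of_heisenberg ψ hψc hψO hψ ω h.1 h.2).exists⟩
  rintro ⟨ν, rfl⟩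
  exact ⟨rep_translate ν, rep_modulate_heisCharA ψ hψc hψO ν⟩

end Unramified

end Characters

end HodgeCM.PerL34.PureTensor.SchrodingerModel

end
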